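import Summits.CriticalPhenomena.PercolationContinuityZ3.Theorems.PercNearOneGluingNoHeavyLowerTailTwoCopyExpansion

/-!
# Crux `NoHeavyLowerTail` (stmt-CriticalPhenomena-4575), certificate programme for the `|A| = 5` one-cut rung:
# computable connection tables of a configuration and their expectations

For the complete edge list `es = allPairs n`, an observer `o` and a relay list `As` (the relay set is
`A = As.toFinset`), every bit-mask configuration `c < 2^m` has computable data
(`AdditiveGluing.Negative.Cert.reachTable` on `pick es c`):

* `connB n es c u v` — `u ↔ v` holds in the configuration (`connB_iff`);
* `relayCount n es As o c` — `N = |{a ∈ A : o ↔ a}|` (`relayCount_eq_card`);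
* the TARGET TABLE of the one-cut family `tT5` (`t_j = 1[a_i ↮ a_i'] − 1[1 ≤ N ≤ 2]` for the `j`-th of
  the ten relay pairs `pairList`) and the HYPOTHESIS TABLE `hT5 = N − 4`.

Their expectations `TwoCopy.ex` under arbitrary weights `w` are the corresponding probabilities
(`ex_connB`, `ex_notConnB`, `ex_lowerTwo`, `ex_relayCount`, `ex_hT5`, `ex_tT5`), by the expansion
`prodBernoulli_real_eq_ex` of `…TwoCopyExpansion`.  Consequence (`lowerTwo_le_of_check_open`): a passed
two-copy check for `(tT5, hT5)` with a certificate `a ≢ 0` gives, for every weight vector in the OPEN cube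
with `Σ_a P(o ↔ a) ≥ 4` and all pairwise relay cuts `≤ t`, the one-cut bound `P(1 ≤ N ≤ 2) ≤ t`.
(The closed cube follows by continuity in the companion file.)  Nothing here asserts the crux.
-/

namespace Summit.CriticalPhenomena.PercolationContinuityZ3.Theorems.TwoCopy

open Finset MeasureTheory
open Literature.Probability.Percolation Literature.Probability.LatticeModels
open Summit.CriticalPhenomena.PercolationContinuityZ3.Theorems.AdditiveGluing.Negative.Cert

/-! ## Computable tables -/

/-- `u ↔ v` in the configuration `c` of the edge list `es` (bit `v` of the reach mask of `u`). [this work] -/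
def connB (n : ℕ) (es : List (Fin n × Fin n)) (c u v : ℕ) : Bool :=
  ((reachTable n (pick es c)).getD u 0).testBit v

/-- The relay count `N(c) = |{a ∈ As : o ↔ a}|`. [this work] -/
def relayCount (n : ℕ) (es : List (Fin n × Fin n)) (As : List (Fin n)) (o : Fin n) (c : ℕ) : ℕ :=
  (As.filter fun a : Fin n => connB n es c (o : ℕ) (a : ℕ)).length

/-- The ten pairs of relay INDICES `(i, i')`, `i < i' < 5`, in lexicographic order. [this work] -/
def pairList : List (ℕ × ℕ) := [(0,1), (0,2), (0,3), (0,4), (1,2), (1,3), (1,4), (2,3), (2,4), (3,4)]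

/-- The `j`-th relay pair as vertices (`j < 10`; junk `o` otherwise). [this work] -/
def pairV (n : ℕ) (As : List (Fin n)) (o : Fin n) (j : ℕ) : Fin n × Fin n :=
  (As.getD (pairList.getD j (0, 0)).1 o, As.getD (pairList.getD j (0, 0)).2 o)

/-- Target table of the one-cut family: `t_j(c) = 1[a ↮ a' in c] − 1[1 ≤ N(c) ≤ 2]` for the `j`-th pair `(a, a')`. [this work] -/
def tT5 (n : ℕ) (es : List (Fin n × Fin n)) (As : List (Fin n)) (o : Fin n) (j c : ℕ) : ℤ :=
  (if connB n es c (pairV n As o j).1 (pairV n As o j).2 then 0 else 1) -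
    (if 1 ≤ relayCount n es As o c ∧ relayCount n es As o c ≤ 2 then 1 else 0)

/-- Hypothesis table of the one-cut family: `h(c) = N(c) − 4`. [this work] -/
def hT5 (n : ℕ) (es : List (Fin n × Fin n)) (As : List (Fin n)) (o : Fin n) (c : ℕ) : ℤ :=
  (relayCount n es As o c : ℤ) - 4

/-! ## Per-configuration soundness -/

open scoped Classical

/-- `connB` decides the two-point connection event of the configuration's edge set. [this work] -/
theorem connB_iff {n : ℕ} (es : List (Fin n × Fin n)) (c : ℕ) (u v : Fin n) :
    connB n es c u v = true ↔ (↑(Eset (pick es c)) : Set (Sym2 (Fin n))) ∈ openConn u v := by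
  unfold connB
  exact testBit_reachTable_iff_mem_openConn (pick es c) u v

/-- The relay count is the cardinality of the relay filter of the configuration's edge set. [this work] -/
theorem relayCount_eq_card {n : ℕ} (es : List (Fin n × Fin n)) {As : List (Fin n)} (hAs : As.Nodup) (o : Fin n) (c : ℕ) :
    relayCount n es As o c =
      (As.toFinset.filter fun a => (↑(Eset (pick es c)) : Set (Sym2 (Fin n))) ∈ openConn o a).card := by
  classical
  unfold relayCount
  rw [← List.toFinset_card_of_nodup (hAs.filter _), List.toFinset_filter]
  congr 1
  refine filter_congr fun a _ => ?_
  exact connB_iff es c o a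

/-- The relay count as a sum of connection indicators. [this work] -/
theorem relayCount_eq_sum {n : ℕ} (es : List (Fin n × Fin n)) {As : List (Fin n)} (hAs : As.Nodup) (o : Fin n) (c : ℕ) :
    (relayCount n es As o c : ℝ) = ∑ a ∈ As.toFinset, (if connB n es c o a then (1 : ℝ) else 0) := by
  classical
  unfold relayCount
  rw [← List.toFinset_card_of_nodup (hAs.filter _), List.toFinset_filter, card_filter]
  push_cast
  refine sum_congr rfl fun a _ => ?_
  split_ifs <;> simp

/-! ## Expectations are probabilities (complete edge list, arbitrary weights) -/

section Expect

variable {n : ℕ} (w : Sym2 (Fin n) → unitInterval)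

/-- Shorthand: the coordinate vector of `w` along `allPairs n`. [this work] -/
noncomputable abbrev wA (w : Sym2 (Fin n) → unitInterval) : ℕ → ℝ := wN w (allPairs n)

/-- Shorthand: the number of coordinates `m = |allPairs n|`. [this work] -/
abbrev mA (n : ℕ) : ℕ := (allPairs n).length

/-- `E_w[1[u ↔ v]] = P_w(u ↔ v)`. [this work] -/
theorem ex_connB (u v : Fin n) :
    ex (mA n) (wA w) (fun c => if connB n (allPairs n) c u v then 1 else 0) =
      (prodBernoulli w).real (openConn u v) := by
  classical
  have hdet : DeterminedBy (openConn u v) (↑(Eset (allPairs n)) : Set (Sym2 (Fin n))) :=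
    determinedBy_allPairs_of_openGraph fun ω ω' h => by simp only [openConn, Set.mem_setOf_eq, h]
  rw [prodBernoulli_real_eq_ex w (allPairs n) (nodup_map_mkE_allPairs n) (openConn u v) hdet]
  refine sum_congr rfl fun c _ => ?_
  dsimp only
  congr 1
  by_cases h : connB n (allPairs n) c u v = true
  · rw [if_pos h, if_pos ((connB_iff _ c u v).1 h)]
  · rw [if_neg h, if_neg (fun h' => h ((connB_iff _ c u v).2 h'))]

/-- `E_w[1[u ↮ v]] = P_w((u ↔ v)ᶜ)`. [this work] -/
theorem ex_notConnB (u v : Fin n) :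
    ex (mA n) (wA w) (fun c => if connB n (allPairs n) c u v then 0 else 1) =
      (prodBernoulli w).real (openConn u v)ᶜ := by
  classical
  have hdet : DeterminedBy (openConn u v)ᶜ (↑(Eset (allPairs n)) : Set (Sym2 (Fin n))) :=
    determinedBy_allPairs_of_openGraph fun ω ω' h => by
      simp only [Set.mem_compl_iff, openConn, Set.mem_setOf_eq, h]
  rw [prodBernoulli_real_eq_ex w (allPairs n) (nodup_map_mkE_allPairs n) (openConn u v)ᶜ hdet]
  refine sum_congr rfl fun c _ => ?_
  dsimp only
  congr 1
  by_cases h : connB n (allPairs n) c u v = true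
  · rw [if_pos h, if_neg (fun h' : _ ∈ (openConn u v)ᶜ => h' ((connB_iff _ c u v).1 h))]
  · rw [if_neg h, if_pos (show _ ∈ (openConn u v)ᶜ from fun h' => h ((connB_iff _ c u v).2 h'))]

/-- `E_w[1[1 ≤ N ≤ 2]] = P_w(1 ≤ N ≤ 2)`. [this work] -/
theorem ex_lowerTwo {As : List (Fin n)} (hAs : As.Nodup) (o : Fin n) :
    ex (mA n) (wA w) (fun c => if 1 ≤ relayCount n (allPairs n) As o c ∧ relayCount n (allPairs n) As o c ≤ 2 then 1 else 0) =
      (prodBernoulli w).real {ω : Set (Sym2 (Fin n)) | 1 ≤ (As.toFinset.filter fun a => ω ∈ openConn o a).card ∧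
        (As.toFinset.filter fun a => ω ∈ openConn o a).card ≤ 2} := by
  classical
  set D : Set (Set (Sym2 (Fin n))) := {ω | 1 ≤ (As.toFinset.filter fun a => ω ∈ openConn o a).card ∧
        (As.toFinset.filter fun a => ω ∈ openConn o a).card ≤ 2} with hDdef
  have hdet : DeterminedBy D (↑(Eset (allPairs n)) : Set (Sym2 (Fin n))) :=
    determinedBy_allPairs_of_openGraph fun ω ω' h => by
      simp only [hDdef, Set.mem_setOf_eq, openConn, h]
  rw [prodBernoulli_real_eq_ex w (allPairs n) (nodup_map_mkE_allPairs n) D hdet]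
  refine sum_congr rfl fun c _ => ?_
  dsimp only
  congr 1
  rw [relayCount_eq_card _ hAs o c]
  simp only [hDdef, Set.mem_setOf_eq]

/-- `E_w[N] = Σ_{a ∈ A} P_w(o ↔ a)`. [this work] -/
theorem ex_relayCount {As : List (Fin n)} (hAs : As.Nodup) (o : Fin n) :
    ex (mA n) (wA w) (fun c => (relayCount n (allPairs n) As o c : ℝ)) =
      ∑ a ∈ As.toFinset, (prodBernoulli w).real (openConn o a) := by
  simp only [relayCount_eq_sum _ hAs]
  rw [ex_sum]
  exact sum_congr rfl fun a _ => ex_connB w o a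

/-- `E_w[h] = Σ_{a ∈ A} P_w(o ↔ a) − 4`. [this work] -/
theorem ex_hT5 {As : List (Fin n)} (hAs : As.Nodup) (o : Fin n) :
    ex (mA n) (wA w) (fun c => (hT5 n (allPairs n) As o c : ℝ)) =
      (∑ a ∈ As.toFinset, (prodBernoulli w).real (openConn o a)) - 4 := by
  have h4 : ex (mA n) (wA w) (fun _ => (4 : ℝ)) = 4 := by
    have := ex_const_mul (mA n) (wA w) 4 (fun _ => 1)
    simp only [mul_one] at this
    rw [this, ex_one w (allPairs n) (nodup_map_mkE_allPairs n), mul_one]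
  unfold hT5
  push_cast
  rw [ex_sub, ex_relayCount w hAs o, h4]

/-- `E_w[t_j] = P_w(a ↮ a') − P_w(1 ≤ N ≤ 2)` for the `j`-th pair `(a, a')`. [this work] -/
theorem ex_tT5 {As : List (Fin n)} (hAs : As.Nodup) (o : Fin n) (j : ℕ) :
    ex (mA n) (wA w) (fun c => (tT5 n (allPairs n) As o j c : ℝ)) =
      (prodBernoulli w).real (openConn (pairV n As o j).1 (pairV n As o j).2)ᶜ -
      (prodBernoulli w).real {ω : Set (Sym2 (Fin n)) | 1 ≤ (As.toFinset.filter fun a => ω ∈ openConn o a).card ∧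
        (As.toFinset.filter fun a => ω ∈ openConn o a).card ≤ 2} := by
  unfold tT5
  push_cast
  rw [ex_sub, ex_notConnB w, ex_lowerTwo w hAs o]

end Expect

/-! ## The one-cut bound on the open cube from a passed check -/

/-- Members of `pairList` are index pairs `i < i' < 5`. [this work] -/
theorem pairList_spec : ∀ j < 10, (pairList.getD j (0, 0)).1 < (pairList.getD j (0, 0)).2 ∧ (pairList.getD j (0, 0)).2 < 5 := by
  decide

/-- Weights are positive on the open cube (coordinates `< m` only). [this work] -/
theorem wt_pos_of_lt (m : ℕ) {w : ℕ → ℝ} (hw : ∀ i < m, 0 < w i ∧ w i < 1) (c : ℕ) : 0 < wt m w c := by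
  unfold wt
  refine prod_pos fun i hi => ?_
  rw [mem_range] at hi
  have h0 := (hw i hi).1; have h1 : 0 < 1 - w i := sub_pos.2 (hw i hi).2
  split_ifs <;> assumption

/-- **The one-cut bound at `|A| = 5` on the OPEN cube from a two-copy certificate.**  If the check for
`(tT5, hT5)` passes with a certificate `a` having a positive entry, then for every weight vector with
all pair weights in `(0, 1)`, `Σ_{a∈A} P(o ↔ a) ≥ 4` and all pairwise relay cuts `≤ t`:
`P(1 ≤ N ≤ 2) ≤ t`. [this work] -/
theorem lowerTwo_le_of_check_open {n : ℕ} {As : List (Fin n)} (hAs : As.Nodup) (hlen : As.length = 5) (o : Fin n)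
    {a : ℕ → ℕ → ℕ} {b : ℕ → ℕ}
    (hc : twoCopyCheck (mA n) 10 (tT5 n (allPairs n) As o) (hT5 n (allPairs n) As o) a b = true)
    {j₀ c₀ : ℕ} (hj₀ : j₀ < 10) (hc₀ : c₀ < 2 ^ mA n) (ha₀ : 0 < a j₀ c₀)
    (w : Sym2 (Fin n) → unitInterval) (hopen : ∀ i < mA n, 0 < wA w i ∧ wA w i < 1)
    (hEN : 4 ≤ ∑ x ∈ As.toFinset, (prodBernoulli w).real (openConn o x))
    (t : ℝ) (hcut : ∀ x ∈ As.toFinset, ∀ x' ∈ As.toFinset, x ≠ x' → (prodBernoulli w).real (openConn x x')ᶜ ≤ t) :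
    (prodBernoulli w).real {ω : Set (Sym2 (Fin n)) | 1 ≤ (As.toFinset.filter fun x => ω ∈ openConn o x).card ∧
        (As.toFinset.filter fun x => ω ∈ openConn o x).card ≤ 2} ≤ t := by
  classical
  set L := (prodBernoulli w).real {ω : Set (Sym2 (Fin n)) | 1 ≤ (As.toFinset.filter fun x => ω ∈ openConn o x).card ∧
        (As.toFinset.filter fun x => ω ∈ openConn o x).card ≤ 2} with hL
  have hw01 : ∀ i, 0 ≤ wA w i ∧ wA w i ≤ 1 := fun i => wN_mem w (allPairs n) i
  -- the certificate inequality
  have hh : 0 ≤ ex (mA n) (wA w) (fun c => (hT5 n (allPairs n) As o c : ℝ)) := by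
    rw [ex_hT5 w hAs o]; linarith
  have key := sum_ex_mul_ex_nonneg_of_check hc hw01 hh
  -- each target expectation is at most `t − L`
  have hcut' : ∀ j ∈ range 10, ex (mA n) (wA w) (fun c => (tT5 n (allPairs n) As o j c : ℝ)) ≤ t - L := by
    intro j hj
    rw [mem_range] at hj
    rw [ex_tT5 w hAs o j]
    have hp := pairList_spec j hj
    have hi1 : (pairList.getD j (0, 0)).1 < As.length := by omega
    have hi2 : (pairList.getD j (0, 0)).2 < As.length := by omega
    have e1 : (pairV n As o j).1 = As[(pairList.getD j (0, 0)).1] := by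
      show As.getD _ o = _
      rw [List.getD_eq_getElem?_getD, List.getElem?_eq_getElem hi1, Option.getD_some]
    have e2 : (pairV n As o j).2 = As[(pairList.getD j (0, 0)).2] := by
      show As.getD _ o = _
      rw [List.getD_eq_getElem?_getD, List.getElem?_eq_getElem hi2, Option.getD_some]
    have hne : As[(pairList.getD j (0, 0)).1] ≠ As[(pairList.getD j (0, 0)).2] := by
      intro h
      have := (List.nodup_iff_injective_getElem.1 hAs) (a₁ := ⟨_, hi1⟩) (a₂ := ⟨_, hi2⟩) h
      simp only [Fin.mk.injEq] at this
      omega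
    have := hcut _ (List.mem_toFinset.2 (List.getElem_mem hi1)) _ (List.mem_toFinset.2 (List.getElem_mem hi2)) hne
    rw [e1, e2]; linarith
  -- Λ = Σ_j E[a_j] > 0
  have hapos : ∀ j, 0 ≤ ex (mA n) (wA w) (fun c => (a j c : ℝ)) := fun j => ex_nonneg _ hw01 fun c => Nat.cast_nonneg _
  have hΛ : 0 < ∑ j ∈ range 10, ex (mA n) (wA w) (fun c => (a j c : ℝ)) := by
    refine lt_of_lt_of_le ?_ (single_le_sum (fun j _ => hapos j) (mem_range.2 hj₀))
    unfold ex
    refine lt_of_lt_of_le ?_ (single_le_sum (fun c _ => mul_nonneg (Nat.cast_nonneg _) (wt_nonneg _ hw01 c)) (mem_range.2 hc₀))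
    exact mul_pos (by exact_mod_cast ha₀) (wt_pos_of_lt _ hopen c₀)
  -- combine
  have hsum : ∑ j ∈ range 10, ex (mA n) (wA w) (fun c => (tT5 n (allPairs n) As o j c : ℝ)) * ex (mA n) (wA w) (fun c => (a j c : ℝ)) ≤
      ∑ j ∈ range 10, (t - L) * ex (mA n) (wA w) (fun c => (a j c : ℝ)) :=
    sum_le_sum fun j hj => mul_le_mul_of_nonneg_right (hcut' j hj) (hapos j)
  rw [← mul_sum] at hsum
  have h3 : 0 ≤ (t - L) * ∑ j ∈ range 10, ex (mA n) (wA w) (fun c => (a j c : ℝ)) := le_trans key hsum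
  by_contra hlt
  have h4 : (t - L) * ∑ j ∈ range 10, ex (mA n) (wA w) (fun c => (a j c : ℝ)) < 0 :=
    mul_neg_of_neg_of_pos (by linarith) hΛ
  linarith

end Summit.CriticalPhenomena.PercolationContinuityZ3.Theorems.TwoCopy
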